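import Summits.CriticalPhenomena.PercolationContinuityZ3.Theorems.PercNearOneGluingNoHeavyConstsUnconditionalChainRule
import Summits.CriticalPhenomena.PercolationContinuityZ3.Theorems.PercNearOneGluingNoHeavyConstsRR2EdgeBernstein
import Summits.CriticalPhenomena.PercolationContinuityZ3.Theorems.PercNearOneGluingNoHeavyLowerTailHullPortMarkerDominanceTools
import Literature.Probability.Percolation.TripodExchange
import Mathlib.LinearAlgebra.Matrix.Determinant.Basic
import HarnessLib
import HarnessLib.Audit.Tags

/-!
# The single-edge chain rule for an avoided vertex hanging from `u`: THEOREM (the `u`-avoiding chain rule with no target set),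
# and the mechanism behind it — marker dominance supplies the between-world term (PAPER-2 track (ii): constants of the CSH family)

builds on p205010 (kernel theorem, internal audit signed; external expert review pending).  Support file (`--supports
stmt-CriticalPhenomena-4575`), seat `prim-consts-2` (gen 7); rows A6/A11 of `run/shared/lean/prim/consts/CONSTANTS.md`; memo
`run/shared/lean/prim/consts/FROM-prim-consts-2-g7-ROW-SPLIT.md` §8.  No definitions, no named facts, no sorries; standard axioms.

Notation: `K(S,T) = μ{S ↮ T}` (`μ = prodBernoulli w`, arbitrary edge weights on a finite vertex type).  The single-edge chain rule CR
(`Consts.SingleEdgeChainRule`, OPEN) is `0 ≤ det[K(S_i, Y ∪ τ_j)]` with `S = ({x},{x,u},{x,u,v})`, `τ = ({v}, ∅, {o})`.  Take for `Y` a single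
vertex `y` whose only possible neighbour is `u` (edge weight `q`): then `K(x, {y} ∪ T) = (1−q) K₀(x,T) + q K₀(x, T ∪ {u})` and
`K({x,u,…}, {y} ∪ T) = (1−q) K₀({x,u,…}, T)` (`K₀` = the kernel of the graph without `y`), so the CR minor equals
`(1−q)² · [ (1−q) · Δ₀ + q · A₀ ]` with `Δ₀` the CR minor for `Y = ∅` (nonnegative: `Consts.singleEdgeChainRule_of_isEmpty`) and

  `A₀ := det [[K(x,{u,v}), K(x,{u}), K(x,{u,o})], [K({x,u},{v}), 1, K({x,u},{o})], [0, 1, K({x,u,v},{o})]]`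

— the chain-rule minor whose FIRST ROW is conditioned on `x ↮ u` ("level 1 avoids `u`") while rows 2, 3 are unconditioned.  So CR for all
instances "`Y` = a vertex pendant at `u`" is EQUIVALENT to `A₀ ≥ 0` for all graphs; this is the simplest class beyond `Y = ∅` in which
the three rows of CR live under DIFFERENT measures (`μ(· | x ↮ u)`, `μ`, `μ`), and the exact numerics of the seat (0 violations in 6 800
random instances, `work/explore/test_A0.py`) said it holds.  This file PROVES it:

* `Consts.chainRule_uAvoid_noTarget` — **THEOREM `A₀ ≥ 0`**, in conditional form
  `P(o ∈ C_x ∪ C_u ∪ C_v) ≥ P(o ∈ C_x | x ↮ u) + P(v ↮ x | x ↮ u) · P(o ∈ C_v | v ↮ {x,u})`.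
  Proof.  `A₀ = K(x,u) · B + M` (a ring identity, `K({x,u,v},{v}) = 0`) with
  `B = K(xu,v)·[K(x,o) − K(xuv,o)] − K(x,v)·[K(xu,o) − K(xuv,o)] ≥ 0` — the `Y = ∅` chain rule (`Consts.singleEdgeChainRule_of_isEmpty`,
  van den Berg–Häggström–Kahn Thm 1.3 for `C_v` given `v ↮ x`), and the BETWEEN-WORLD term
  `M = K(xu,v)·[K(x,{u,o}) − K(x,u)K(x,o)] − [K(x,{u,v}) − K(x,u)K(x,v)]·[K(xu,o) − K(xuv,o)]`
  ` = μ(v ∉ C_{xu}) · Cov(1{o ∈ C_x}, 1{u ∈ C_x}) − Cov(1{v ∈ C_x}, 1{u ∈ C_x}) · μ(o ∈ C_v, v ↮ {x,u}) ≥ 0`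
  (`Consts.cov_reach_mul_le`): the MARKER DOMINANCE lemma of the tree (`HullPort.markerDominance_noAvoid`, functional `F = 1{u ∈ C_x}`,
  markers `v, o`) gives `μ(x ↮ v) · Cov(o,u) ≥ μ(v ↔ o, x ↮ v) · Cov(v,u)`, vdBHK Thm 1.3 (inc/dec, `C_v` given `v ↮ x`) gives
  `μ(v ↮ xu) · μ(v ↔ o, v ↮ x) ≥ μ(v ↮ x) · μ(v ↔ o, v ↮ xu)`, and Harris gives `Cov(v,u) ≥ 0`.
  So in this class the "genuine" part of CR is vdBHK's inequality and the between-world part is EXACTLY marker dominance (the `X = ∅` case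
  of MDL(X), `T/…LowerTailHullPortMarkerDominanceTools.lean`): the chain rule and the covariance-transfer lemma of paper 1 are the same
  phenomenon here.  (Memo §3: for general `Y` the between-world part `S3` is the analogue with `Cov_{μ(·|x↮Y)}(1{t ∈ C_x}, 1{u ↮ Y})`.)
* `Consts.cov_reach_eq_avoid` — the covariance in kernel form: `μ({x↔z} ∩ {x↔u}) − μ{x↔u} μ{x↔z} = K(x,{u,z}) − K(x,{u}) K(x,{z})`.
[cite: VandenbergHaggstromKahn2005, Thm. 1.3 (p. 6), Thm. 1.1 (pp. 3–5)]
-/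

noncomputable section

namespace Summit.CriticalPhenomena.PercolationContinuityZ3.Theorems

open MeasureTheory Set Literature.Probability.LatticeModels Literature.Probability.Percolation
open scoped Classical

namespace Consts

/-- Notation (this file only): the disconnection kernel `𝕂[w](S, T) = μ_w{S ↮ T}`. -/
local notation3 "𝕂[" w "](" S ", " T ")" =>
  MeasureTheory.Measure.real (prodBernoulli w) {ω | ∀ s ∈ S, ∀ t ∈ T, ¬ (openGraph ω).Reachable s t}

variable {V : Type*} [Fintype V]

/-- **The covariance of two connection events from `x`, in kernel form**:
`μ({x↔z} ∩ {x↔u}) − μ{x↔u}·μ{x↔z} = K(x,{u,z}) − K(x,{u})·K(x,{z})`. [folklore] -/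
theorem cov_reach_eq_avoid (w : Sym2 V → unitInterval) (x u z : V) :
    (prodBernoulli w).real (openConn x u ∩ openConn x z) -
        (prodBernoulli w).real (openConn x u) * (prodBernoulli w).real (openConn x z) =
      𝕂[w](({x} : Set V), ({u, z} : Set V)) - 𝕂[w](({x} : Set V), ({u} : Set V)) * 𝕂[w](({x} : Set V), ({z} : Set V)) := by
  classical
  set μ := prodBernoulli w with hμ
  have hmeas : ∀ T : Set (BondConfig V), MeasurableSet T := fun _ => MeasurableSet.of_discrete
  have hsing : ∀ a' : V, {ω : BondConfig V | ∀ s ∈ ({x} : Set V), ∀ t ∈ ({a'} : Set V), ¬ (openGraph ω).Reachable s t} =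
      (openConn x a')ᶜ := fun a' => by ext ω; simp [openConn]
  have hpair : {ω : BondConfig V | ∀ s ∈ ({x} : Set V), ∀ t ∈ ({u, z} : Set V), ¬ (openGraph ω).Reachable s t} =
      (openConn x u)ᶜ ∩ (openConn x z)ᶜ := by ext ω; simp [openConn]
  rw [hpair, hsing u, hsing z]
  set U : Set (BondConfig V) := openConn x u with hU
  set Z : Set (BondConfig V) := openConn x z with hZ
  have h1 : μ.real (U ∩ Z) + μ.real (U \ Z) = μ.real U := measureReal_inter_add_sdiff (hmeas Z)
  have h2 : μ.real (Zᶜ ∩ U) + μ.real (Zᶜ \ U) = μ.real Zᶜ := measureReal_inter_add_sdiff (hmeas U)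
  have h3 : μ.real U + μ.real Uᶜ = 1 := by rw [measureReal_add_measureReal_compl (hmeas U), probReal_univ]
  have h4 : μ.real Z + μ.real Zᶜ = 1 := by rw [measureReal_add_measureReal_compl (hmeas Z), probReal_univ]
  have e1 : U \ Z = Zᶜ ∩ U := by ext ω; simp only [mem_sdiff, mem_inter_iff, mem_compl_iff]; tauto
  have e2 : Zᶜ \ U = Uᶜ ∩ Zᶜ := by ext ω; simp only [mem_sdiff, mem_inter_iff, mem_compl_iff]; tauto
  rw [e1] at h1; rw [e2] at h2
  linear_combination h1 - h2 + μ.real Zᶜ * h3 - μ.real U * h4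

/-- **The between-world term is nonnegative (marker dominance).**  For all `x, u, v, o`:
`[K(x,{u,v}) − K(x,u)K(x,v)] · [K(xu,o) − K(xuv,o)] ≤ K(xu,v) · [K(x,{u,o}) − K(x,u)K(x,o)]`, i.e.
`Cov(1{v∈C_x},1{u∈C_x}) · μ(o ∈ C_v, v ↮ {x,u}) ≤ μ(v ∉ C_{xu}) · Cov(1{o∈C_x},1{u∈C_x})`.  Marker dominance
(`HullPort.markerDominance_noAvoid` for `F = 1{u ∈ C_x}`, markers `v`, `o`) + vdBHK Thm 1.3 (`C_v` given `v ↮ x`, increasing `1{o∈C_v}`,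
decreasing `1{u∉C_v}`) + Harris (`Cov(v,u) ≥ 0`). [cite: VandenbergHaggstromKahn2005, Thm. 1.3 (p. 6)] -/
theorem cov_reach_mul_le (w : Sym2 V → unitInterval) (x u v o : V) :
    (𝕂[w](({x} : Set V), ({u, v} : Set V)) - 𝕂[w](({x} : Set V), ({u} : Set V)) * 𝕂[w](({x} : Set V), ({v} : Set V))) *
        (𝕂[w](({x, u} : Set V), ({o} : Set V)) - 𝕂[w](({x, u, v} : Set V), ({o} : Set V))) ≤
      𝕂[w](({x, u} : Set V), ({v} : Set V)) *
        (𝕂[w](({x} : Set V), ({u, o} : Set V)) - 𝕂[w](({x} : Set V), ({u} : Set V)) * 𝕂[w](({x} : Set V), ({o} : Set V))) := by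
  classical
  set μ := prodBernoulli w with hμ
  have hmeas : ∀ T : Set (BondConfig V), MeasurableSet T := fun _ => MeasurableSet.of_discrete
  -- names for the kernel entries
  set a := 𝕂[w](({x} : Set V), ({u} : Set V)) with ha
  set b := 𝕂[w](({x} : Set V), ({v} : Set V)) with hb
  set c := 𝕂[w](({x} : Set V), ({o} : Set V)) with hc
  set d := 𝕂[w](({x} : Set V), ({u, v} : Set V)) with hd
  set e := 𝕂[w](({x} : Set V), ({u, o} : Set V)) with he
  set s := 𝕂[w](({x, u} : Set V), ({v} : Set V)) with hs
  set t := 𝕂[w](({x, u} : Set V), ({o} : Set V)) with ht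
  set z := 𝕂[w](({x, u, v} : Set V), ({o} : Set V)) with hz
  -- events seen from `v`
  set Dv : Set (BondConfig V) := {ω | ∀ t' ∈ ({x} : Set V), ¬ (openGraph ω).Reachable v t'} with hDv
  set Ov : Set (BondConfig V) := openConn v o with hOv
  set Uv : Set (BondConfig V) := openConn v u with hUv
  -- (0) covariances in kernel form and their signs
  have hcov_o : μ.real (openConn x u ∩ openConn x o) - μ.real (openConn x u) * μ.real (openConn x o) = e - a * c :=
    cov_reach_eq_avoid w x u o
  have hcov_v : μ.real (openConn x u ∩ openConn x v) - μ.real (openConn x u) * μ.real (openConn x v) = d - a * b :=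
    cov_reach_eq_avoid w x u v
  -- Harris (= vdBHK Thm 1.3 with an empty avoided set): `Cov ≥ 0`
  have hHarris : ∀ t' : V, 𝕂[w](({x} : Set V), ({u} : Set V)) * 𝕂[w](({x} : Set V), ({t'} : Set V)) ≤
      𝕂[w](({x} : Set V), ({u, t'} : Set V)) := by
    intro t'
    have h := real_avoid_insert_mul_le w (∅ : Set V) ({x} : Set V) u t'
    have h0 : {ω : BondConfig V | ∀ s' ∈ (∅ : Set V), ∀ t ∈ ({x} : Set V), ¬ (openGraph ω).Reachable s' t} = univ := by
      ext ω; simp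
    rw [h0, probReal_univ, one_mul, ← Set.singleton_def, ← Set.singleton_def] at h
    rw [setOf_avoid_comm ({x} : Set V) ({u} : Set V), setOf_avoid_comm ({x} : Set V) ({t'} : Set V),
      setOf_avoid_comm ({x} : Set V) ({u, t'} : Set V), show ({u, t'} : Set V) = ({t', u} : Set V) from pair_comm _ _]
    exact h
  have h3 : 0 ≤ d - a * b := by have := hHarris v; rw [← hd, ← ha, ← hb] at this; linarith
  have h4 : 0 ≤ e - a * c := by have := hHarris o; rw [← he, ← ha, ← hc] at this; linarith
  have hs0 : 0 ≤ s := measureReal_nonneg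
  -- degenerate case `x = v`: `b = 0`, `d = 0`
  by_cases hxv : x = v
  · have hd0 : d = 0 := by
      have : {ω : BondConfig V | ∀ s' ∈ ({v} : Set V), ∀ t' ∈ ({u, v} : Set V), ¬ (openGraph ω).Reachable s' t'} = ∅ := by
        ext ω; simp only [mem_setOf_eq, mem_empty_iff_false, iff_false, not_forall, not_not]
        exact ⟨v, rfl, v, by simp, SimpleGraph.Reachable.refl _⟩
      rw [hd, hxv, this]; simp
    have hb0 : b = 0 := by
      have : {ω : BondConfig V | ∀ s' ∈ ({v} : Set V), ∀ t' ∈ ({v} : Set V), ¬ (openGraph ω).Reachable s' t'} = ∅ := by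
        ext ω; simp only [mem_setOf_eq, mem_empty_iff_false, iff_false, not_forall, not_not]
        exact ⟨v, rfl, v, rfl, SimpleGraph.Reachable.refl _⟩
      rw [hb, hxv, this]; simp
    rw [hd0, hb0]
    nlinarith [hs0, h4, mul_nonneg hs0 h4]
  -- (1) marker dominance for `F = 1{u ∈ C_x}`, markers `v` (the `y`) and `o` (the `z`)
  have hF0 : ∀ C, 0 ≤ connIndicatorFn x u C := by
    intro C; unfold connIndicatorFn; split_ifs <;> norm_num
  have mdl := HullPort.markerDominance_noAvoid w x v o hxv (connIndicatorFn x u) (monotone_connIndicatorFn x u) hF0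
  simp only [connIndicatorFn_openEdgeCluster, integral_indicator_one (hmeas _)] at mdl
  rw [measureReal_restrict_apply (hmeas _), measureReal_restrict_apply (hmeas _)] at mdl
  -- mdl : μ((x↔v)ᶜ ∩ (v↔o)) * (μ((x↔u) ∩ (x↔v)) − μ(x↔u) μ(x↔v)) ≤ μ((x↔v)ᶜ) * (μ((x↔u) ∩ (x↔o)) − μ(x↔u) μ(x↔o))
  rw [hcov_o, hcov_v] at mdl
  have hN : μ.real ((openConn x v : Set (BondConfig V))ᶜ) = b := by
    rw [hb]; congr 1; ext ω; simp [openConn]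
  rw [hN] at mdl
  set w1 := μ.real ((openConn x v : Set (BondConfig V))ᶜ ∩ openConn v o) with hw1
  -- (2) vdBHK Thm 1.3 (inc/dec) for `C_v` given `v ↮ x`: `s · w1 ≥ b · (t − z)`
  have hvx : v ∉ ({x} : Set V) := fun h => hxv (mem_singleton_iff.1 h).symm
  have key := BHK2006_clusterConditionalPositiveAssociation.antitone_right BHK2006_clusterConditionalPositiveAssociation_holds
    V w v {x} (connIndicatorFn v o) (fun C => 1 - connIndicatorFn v u C) (monotone_connIndicatorFn v o)
    (fun C C' hCC' => by linarith [monotone_connIndicatorFn v u hCC']) hvx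
  have hGω : ∀ ω : BondConfig V, (1 : ℝ) - (openConn v u).indicator 1 ω = (Uvᶜ).indicator 1 ω := by
    intro ω
    by_cases h : ω ∈ Uv
    · rw [hUv] at h; rw [indicator_of_mem h, indicator_of_notMem (fun h' => (Set.mem_compl_iff _ _).mp h' h)]; simp
    · rw [hUv] at h; rw [indicator_of_notMem h, indicator_of_mem (show ω ∈ (openConn v u)ᶜ from h)]; simp
  simp only [connIndicatorFn_openEdgeCluster, hGω, TripodExchange.setIntegral_indicator_one_eq,
    TripodExchange.setIntegral_indicator_mul_indicator_eq] at key
  -- key : μ.real Dv * μ.real (Dv ∩ (Ov ∩ Uvᶜ)) ≤ μ.real (Dv ∩ Ov) * μ.real (Dv ∩ Uvᶜ)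
  have hDvb : μ.real Dv = b := by
    rw [hb]; congr 1; ext ω
    simp only [hDv, mem_setOf_eq, mem_singleton_iff, forall_eq]
    exact ⟨fun h h' => h h'.symm, fun h h' => h h'.symm⟩
  have hDvOv : μ.real (Dv ∩ Ov) = w1 := by
    rw [hw1]; congr 1; ext ω
    simp only [hDv, hOv, mem_inter_iff, mem_setOf_eq, mem_singleton_iff, forall_eq, mem_compl_iff, openConn]
    exact ⟨fun h => ⟨fun h' => h.1 h'.symm, h.2⟩, fun h => ⟨fun h' => h.1 h'.symm, h.2⟩⟩
  have hDvUv : μ.real (Dv ∩ Uvᶜ) = s := by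
    rw [hs]; congr 1; ext ω
    simp only [hDv, hUv, mem_inter_iff, mem_setOf_eq, mem_insert_iff, mem_singleton_iff, forall_eq_or_imp, forall_eq,
      mem_compl_iff, openConn]
    exact ⟨fun h => ⟨fun h' => h.1 h'.symm, fun h' => h.2 h'.symm⟩, fun h => ⟨fun h' => h.1 h'.symm, fun h' => h.2 h'.symm⟩⟩
  have hDvOU : μ.real (Dv ∩ (Ov ∩ Uvᶜ)) = t - z := by
    have hsub : {ω : BondConfig V | ∀ s' ∈ ({x, u, v} : Set V), ∀ t' ∈ ({o} : Set V), ¬ (openGraph ω).Reachable s' t'} ⊆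
        {ω : BondConfig V | ∀ s' ∈ ({x, u} : Set V), ∀ t' ∈ ({o} : Set V), ¬ (openGraph ω).Reachable s' t'} := by
      intro ω h; simp only [mem_setOf_eq] at h ⊢
      exact fun s' hs' t' ht' => h s' (by simp only [mem_insert_iff, mem_singleton_iff] at hs' ⊢; tauto) t' ht'
    have hdiff : {ω : BondConfig V | ∀ s' ∈ ({x, u} : Set V), ∀ t' ∈ ({o} : Set V), ¬ (openGraph ω).Reachable s' t'} \
        {ω : BondConfig V | ∀ s' ∈ ({x, u, v} : Set V), ∀ t' ∈ ({o} : Set V), ¬ (openGraph ω).Reachable s' t'} =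
        Dv ∩ (Ov ∩ Uvᶜ) := by
      ext ω
      simp only [mem_sdiff, mem_setOf_eq, mem_insert_iff, mem_singleton_iff, forall_eq_or_imp, forall_eq, hDv, hOv, hUv,
        mem_inter_iff, mem_compl_iff, openConn]
      constructor
      · rintro ⟨⟨hxo, huo⟩, h2⟩
        have hvo : (openGraph ω).Reachable v o := by
          by_contra hvo; exact h2 ⟨hxo, huo, hvo⟩
        exact ⟨fun hvx => hxo (hvx.symm.trans hvo), hvo, fun hvu => huo (hvu.symm.trans hvo)⟩
      · rintro ⟨hvx, hvo, hvu⟩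
        exact ⟨⟨fun hxo => hvx (hvo.trans hxo.symm), fun huo => hvu (hvo.trans huo.symm)⟩, fun h => h.2.2 hvo⟩
    rw [ht, hz, ← measureReal_sdiff hsub (hmeas _), hdiff]
  rw [hDvb, hDvOv, hDvUv, hDvOU] at key
  -- key : b * (t - z) ≤ w1 * s ;  mdl : w1 * (d - a*b) ≤ b * (e - a*c)
  have hw1 : 0 ≤ w1 := measureReal_nonneg
  have hb0 : 0 ≤ b := measureReal_nonneg
  by_cases hbz : b = 0
  · -- then `d ≤ b = 0`
    have hdle : d ≤ b := by
      rw [hd, hb]; exact measureReal_mono (fun ω h s' hs' t' ht' => h s' hs' t' (mem_insert_of_mem u ht'))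
    have hd0 : d = 0 := le_antisymm (hbz ▸ hdle) measureReal_nonneg
    have hab : a * b = 0 := by rw [hbz, mul_zero]
    rw [hd0, hab, sub_zero, zero_mul]
    exact mul_nonneg hs0 h4
  · have hbpos : 0 < b := lt_of_le_of_ne hb0 (Ne.symm hbz)
    -- `b · [s (e − ac) − (d − ab)(t − z)] ≥ s·w1·(d−ab) − (d−ab)·w1·s = 0`
    have h1 : b * ((d - a * b) * (t - z)) ≤ (d - a * b) * (w1 * s) := by
      have := mul_le_mul_of_nonneg_left key h3
      linarith
    have h2 : (d - a * b) * (w1 * s) ≤ b * (s * (e - a * c)) := by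
      have := mul_le_mul_of_nonneg_left mdl hs0
      linarith
    exact le_of_mul_le_mul_left (by linarith) hbpos

/-! ### The `u`-avoiding chain rule with no target set -/

/-- **THEOREM — the `u`-avoiding chain rule (`A₀ ≥ 0`); equivalently, the single-edge chain rule for an avoided vertex pendant at `u`.**
For every finite weighted graph and all `x, u, v, o`:
`0 ≤ det [[K(x,{u,v}), K(x,{u}), K(x,{u,o})], [K({x,u},{v}), K({x,u},∅), K({x,u},{o})], [K({x,u,v},{v}), K({x,u,v},∅), K({x,u,v},{o})]]`
(`K(S,∅) = 1`, `K({x,u,v},{v}) = 0`), i.e. `P(o ∈ C_x ∪ C_u ∪ C_v) ≥ P(o ∈ C_x | x ↮ u) + P(v ↮ x | x ↮ u) · P(o ∈ C_v | v ↮ {x,u})`.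
Proof: `A₀ = K(x,u) · B + M` with `B ≥ 0` the `Y = ∅` chain rule (`Consts.singleEdgeChainRule_of_isEmpty`) and `M ≥ 0` the marker-dominance
term (`Consts.cov_reach_mul_le`).  If `y` is a vertex whose only possible neighbour is `u` (weight `q`), the CR minor at `(x,u,v,o,{y})` equals
`(1−q)²[(1−q)Δ₀ + qA₀]`, so this theorem is CR for that class. [cite: VandenbergHaggstromKahn2005, Thm. 1.3 (p. 6), Thm. 1.1 (pp. 3–5)] -/
theorem chainRule_uAvoid_noTarget (w : Sym2 V → unitInterval) (x u v o : V) :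
    0 ≤ Matrix.det !![
      𝕂[w](({x} : Set V), ({u, v} : Set V)), 𝕂[w](({x} : Set V), ({u} : Set V)), 𝕂[w](({x} : Set V), ({u, o} : Set V));
      𝕂[w](({x, u} : Set V), ({v} : Set V)), 𝕂[w](({x, u} : Set V), (∅ : Set V)), 𝕂[w](({x, u} : Set V), ({o} : Set V));
      𝕂[w](({x, u, v} : Set V), ({v} : Set V)), 𝕂[w](({x, u, v} : Set V), (∅ : Set V)),
        𝕂[w](({x, u, v} : Set V), ({o} : Set V))] := by
  classical
  set μ := prodBernoulli w with hμ
  have hmeas : ∀ T : Set (BondConfig V), MeasurableSet T := fun _ => MeasurableSet.of_discrete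
  set a := 𝕂[w](({x} : Set V), ({u} : Set V)) with ha
  set b := 𝕂[w](({x} : Set V), ({v} : Set V)) with hb
  set c := 𝕂[w](({x} : Set V), ({o} : Set V)) with hc
  set d := 𝕂[w](({x} : Set V), ({u, v} : Set V)) with hd
  set e := 𝕂[w](({x} : Set V), ({u, o} : Set V)) with he
  set s := 𝕂[w](({x, u} : Set V), ({v} : Set V)) with hs
  set t := 𝕂[w](({x, u} : Set V), ({o} : Set V)) with ht
  set z := 𝕂[w](({x, u, v} : Set V), ({o} : Set V)) with hz
  -- trivial entries
  have hK2e : 𝕂[w](({x, u} : Set V), (∅ : Set V)) = 1 := by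
    have : {ω : BondConfig V | ∀ s' ∈ ({x, u} : Set V), ∀ t' ∈ (∅ : Set V), ¬ (openGraph ω).Reachable s' t'} = univ := by
      ext ω; simp
    rw [this]; simp
  have hK3e : 𝕂[w](({x, u, v} : Set V), (∅ : Set V)) = 1 := by
    have : {ω : BondConfig V | ∀ s' ∈ ({x, u, v} : Set V), ∀ t' ∈ (∅ : Set V), ¬ (openGraph ω).Reachable s' t'} = univ := by
      ext ω; simp
    rw [this]; simp
  have hK3v : 𝕂[w](({x, u, v} : Set V), ({v} : Set V)) = 0 := by
    have : {ω : BondConfig V | ∀ s' ∈ ({x, u, v} : Set V), ∀ t' ∈ ({v} : Set V), ¬ (openGraph ω).Reachable s' t'} = ∅ := by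
      ext ω
      simp only [mem_setOf_eq, mem_empty_iff_false, iff_false, not_forall, not_not]
      exact ⟨v, by simp, v, rfl, SimpleGraph.Reachable.refl _⟩
    rw [this]; simp
  -- (1) the between-world term `M ≥ 0`
  have hM : (d - a * b) * (t - z) ≤ s * (e - a * c) := cov_reach_mul_le w x u v o
  -- (2) the `Y = ∅` chain rule `B = s (c − z) − b (t − z) ≥ 0`
  have hB : b * (t - z) ≤ s * (c - z) := by
    have h := singleEdgeChainRule_of_isEmpty w x u v o
    have hR1 : {ω : BondConfig V | ∀ y ∈ (∅ : Set V), ¬ (openGraph ω).Reachable x y} = univ := by ext ω; simp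
    have hR2 : {ω : BondConfig V | ∀ y ∈ (∅ : Set V), ¬ (openGraph ω).Reachable x y ∧ ¬ (openGraph ω).Reachable u y} = univ := by
      ext ω; simp
    have hR3 : {ω : BondConfig V | ∀ y ∈ (∅ : Set V), ¬ (openGraph ω).Reachable x y ∧ ¬ (openGraph ω).Reachable u y ∧
        ¬ (openGraph ω).Reachable v y} = univ := by
      ext ω; simp
    rw [hR1, hR2, hR3] at h
    simp only [univ_inter, probReal_univ, mul_one] at h
    -- identify the five probabilities
    have hN1 : μ.real {ω : BondConfig V | ¬ (openGraph ω).Reachable x v} = b := by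
      rw [hb]; congr 1; ext ω; simp
    have hN2 : μ.real {ω : BondConfig V | ¬ (openGraph ω).Reachable x v ∧ ¬ (openGraph ω).Reachable u v} = s := by
      rw [hs]; congr 1; ext ω
      simp only [mem_setOf_eq, mem_insert_iff, mem_singleton_iff, forall_eq_or_imp, forall_eq]
    have hA1 : μ.real (openConn x o : Set (BondConfig V)) = 1 - c := by
      have := measureReal_add_measureReal_compl (μ := μ) (hmeas (openConn x o))
      rw [probReal_univ] at this
      have hset : (openConn x o : Set (BondConfig V))ᶜ =
          {ω : BondConfig V | ∀ s' ∈ ({x} : Set V), ∀ t' ∈ ({o} : Set V), ¬ (openGraph ω).Reachable s' t'} := by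
        ext ω; simp [openConn]
      rw [hc, ← hset]; linarith
    have hA2 : μ.real (openConn x o ∪ openConn u o : Set (BondConfig V)) = 1 - t := by
      have := measureReal_add_measureReal_compl (μ := μ) (hmeas (openConn x o ∪ openConn u o))
      rw [probReal_univ] at this
      have hset : (openConn x o ∪ openConn u o : Set (BondConfig V))ᶜ =
          {ω : BondConfig V | ∀ s' ∈ ({x, u} : Set V), ∀ t' ∈ ({o} : Set V), ¬ (openGraph ω).Reachable s' t'} := by
        ext ω
        simp only [mem_compl_iff, mem_union, openConn, mem_setOf_eq, mem_insert_iff, mem_singleton_iff, forall_eq_or_imp,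
          forall_eq, not_or]
      rw [ht, ← hset]; linarith
    have hA3 : μ.real (openConn x o ∪ openConn u o ∪ openConn v o : Set (BondConfig V)) = 1 - z := by
      have := measureReal_add_measureReal_compl (μ := μ) (hmeas (openConn x o ∪ openConn u o ∪ openConn v o))
      rw [probReal_univ] at this
      have hset : (openConn x o ∪ openConn u o ∪ openConn v o : Set (BondConfig V))ᶜ =
          {ω : BondConfig V | ∀ s' ∈ ({x, u, v} : Set V), ∀ t' ∈ ({o} : Set V), ¬ (openGraph ω).Reachable s' t'} := by
        ext ω
        simp only [mem_compl_iff, mem_union, openConn, mem_setOf_eq, mem_insert_iff, mem_singleton_iff, forall_eq_or_imp,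
          forall_eq, not_or]
        tauto
      rw [hz, ← hset]; linarith
    rw [hN1, hN2, hA1, hA2, hA3] at h
    linarith
  have ha0 : 0 ≤ a := measureReal_nonneg
  have hdet : Matrix.det !![d, a, e; s, 𝕂[w](({x, u} : Set V), (∅ : Set V)), t;
      𝕂[w](({x, u, v} : Set V), ({v} : Set V)), 𝕂[w](({x, u, v} : Set V), (∅ : Set V)), z] =
      a * (s * (c - z) - b * (t - z)) + (s * (e - a * c) - (d - a * b) * (t - z)) := by
    rw [Matrix.det_fin_three]
    simp only [Matrix.of_apply, Matrix.cons_val', Matrix.cons_val_zero, Matrix.cons_val_one, Matrix.cons_val_two,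
      Matrix.empty_val', Matrix.cons_val_fin_one, Matrix.head_cons, Matrix.tail_cons, Matrix.head_fin_const, hK2e, hK3e, hK3v]
    ring
  rw [hdet]
  exact add_nonneg (mul_nonneg ha0 (by linarith)) (by linarith)

end Consts

end Summit.CriticalPhenomena.PercolationContinuityZ3.Theorems

end
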